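import Literature.Geometry.Lorentzian.KerrSchildLeafCurrents
import Literature.Geometry.Lorentzian.TimeCones
import HarnessLib

/-!
# Comparability of the `∂_{t*}`- and `V`-energies through the hyperboloidal leaves and the
# Kerr–Schild slices in the far region, and the dominant energy condition for causal multipliers

(family `gr`; infrastructure for the far-region estimates behind statement **gr.S24** —
Dafermos–Rodnianski–Shlapentokh-Rothman, arXiv:1402.7034 = Ann. of Math. 183 (2016), §2.2.2,
§2.3, §3.1 (footnote on `N`), §3.3; namespaces `Literature.Geometry.Lorentzian.LorentzianMetric`,
`Literature.Geometry.Lorentzian.Kerr`)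

The far-region energy identities behind the `r^p` hierarchy on Kerr
(`Kerr.dafermosRodnianski_pHierarchy_scri`, `KerrDecayHierarchy.lean`) are most conveniently run
with the **Killing** multiplier `T = ∂_{t*}` (exact conservation, `K^T = 0`:
`KerrSchild.sum_fderiv_multiplierCurrent_timeTranslation`), whereas the fluxes of that fact are
`V`-fluxes, `V = −g♯dt* = ∂_{t*} − 2Hℓ♯` (`Kerr.leafFlux`, `Kerr.leafFluxDensity = T[ψ](V, W)`). In
the far region the two are comparable through every leaf `Σ̃_τ(h♯_{R₁})` and every slice
`{t* = const}`, with constants independent of the (asymptotically null) leaf: this file proves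

* `LorentzianMetric.stressEnergy_nonneg_of_isFutureDirected` — **the dominant energy condition for
  a future causal multiplier**: `0 ≤ T[ψ](N, W)` for `N` future-directed causal (possibly null)
  and `W` future-directed timelike (from the timelike case
  `LorentzianMetric.stressEnergy_nonneg_of_isTimelike` applied to `N + εW`, `ε ↓ 0`);
  `LorentzianMetric.stressEnergy_le_of_isFutureDirected_sub` — monotonicity: `T(Y, W) ≤ T(X, W)`
  whenever `X − Y` is future-directed causal;
* for subextremal Kerr, at a point `x` of the exterior (`Kerr.isFutureDirected_basisVector_zero`,
  `Kerr.isFutureDirected_neg_nullVector`, …): `∂_{t*}` is future timelike where `2H < 1`,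
  `−ℓ♯` is future null, `V − ∂_{t*} = 2H(−ℓ♯)` is future causal, and `2∂_{t*} − V` is future
  timelike where `H ≤ 1/8`; hence for every future-directed timelike `W`
  (`Kerr.stressEnergy_basisVector_zero_le_timeVector`, `Kerr.stressEnergy_timeVector_le_two_mul`):
  `T(∂_{t*}, W) ≤ T(V, W)` everywhere on the exterior and `T(V, W) ≤ 2 T(∂_{t*}, W)` where
  `H ≤ 1/8` (e.g. `r ≥ 8M`, `Kerr.scalarH_le_one_div_eight`), and `0 ≤ T(∂_{t*}, W)` where
  `2H < 1`;
* the specialisations to the leaf normals `W = −g♯d(t* − h♯_{R₁})` (`R₁ > 2M`) and to the slice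
  normal `W = V`, and their **coordinate forms** through `KerrSchildLeafCurrents.lean`: with
  `(J^T)^μ`, `(J^V)^μ` the multiplier currents of `∂_{t*}` and `V` for `g⁻¹_{M,a}`
  (`KerrSchild.multiplierCurrent (Kerr.inverseMetric M a) …`) and `n` the graph conormal of the leaf
  (resp. `n = dt*` for the slice),
  `0 ≤ −∑(J^T)^μ n_μ ≤ −∑(J^V)^μ n_μ ≤ 2 (−∑(J^T)^μ n_μ)` at exterior points with `H ≤ 1/8`
  (`Kerr.neg_sum_tMultiplierCurrent_leaf_comparison`, `Kerr.neg_sum_tMultiplierCurrent_slice_comparison`).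

This is the comparability "`J^N_μ n^μ ∼ J^T_μ n^μ` for `r ≥ R`" used tacitly throughout DRSR §3–§4
(footnote to §3.1: only "`φ_τ`-invariant, strictly timelike and asymptotic to `T` for large `r`"
matters) and in Moschidis (arXiv:1509.08489, Lemma 4.5, the `J^T`-energy through hyperboloids), in
the form needed on leaves through which both densities degenerate. No definitions, no named facts
(D-0026).

## References

* M. Dafermos, I. Rodnianski, Y. Shlapentokh-Rothman, arXiv:1402.7034 = Ann. of Math. 183 (2016),
  §2.2.2 (`T` timelike outside the ergoregion), §2.3.1–§2.3.2, §3.1 (footnote on `N`), §3.3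
  (key `DafermosRodnianskiShlapentokhrothman2014`).
* G. Moschidis, arXiv:1509.08489 = Ann. PDE 2 (2016), Lemma 4.5 (key `Moschidis2016`).
* S. W. Hawking, G. F. R. Ellis, *The large scale structure of space-time* (1973), §4.3 (dominant
  energy condition) (key `HawkingEllis1973`).
* B. O'Neill, *Semi-Riemannian geometry* (1983), Ch. 5, Lemma 5.29, p. 145 (timecones)
  (key `ONeillSemiRiemannian1983`).
-/

noncomputable section

open Bundle Set TopologicalSpace Filter
open scoped Manifold ContDiff Topology ENNReal

namespace Literature.Geometry.Lorentzian

/-! ### The dominant energy condition for a future causal multiplier -/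

section DEC

variable {E : Type*} [NormedAddCommGroup E] [NormedSpace ℝ E] {H : Type*} [TopologicalSpace H]
  {I : ModelWithCorners ℝ E H} {M : Type*} [TopologicalSpace M] [ChartedSpace H M]
  [IsManifold I ∞ M] {n : ℕ∞ω} [FiniteDimensional ℝ E]

namespace LorentzianMetric

variable {g : LorentzianMetric I n M} (τ : TimeOrientation g) {x : M}

omit [FiniteDimensional ℝ E] in
/-- A positive multiple of a future-directed vector is future-directed. O'Neill 1983, Ch. 5,
p. 145. [cite: ONeillSemiRiemannian1983, Ch. 5, p. 145] -/
theorem _root_.Literature.Geometry.Lorentzian.TimeOrientation.IsFutureDirected.smul_pos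
    {v : TangentSpace I x} (hv : τ.IsFutureDirected v) {c : ℝ} (hc : 0 < c) :
    τ.IsFutureDirected (c • v) := by
  refine ⟨⟨?_, ?_⟩, ?_⟩
  · have h := hv.1.1
    simp only [map_smul, smul_apply, smul_eq_mul]
    exact mul_nonpos_of_nonneg_of_nonpos hc.le (mul_nonpos_of_nonneg_of_nonpos hc.le h)
  · exact smul_ne_zero hc.ne' hv.1.2
  · have h := hv.2
    rw [map_smul, smul_eq_mul]
    exact mul_neg_of_pos_of_neg hc h

/-- **The dominant energy condition for a future causal multiplier.** For a Lorentzian metric with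
time orientation `τ`, a future-directed causal vector `N` (possibly null), a future-directed
timelike vector `W` and any scalar field `ψ`: `0 ≤ T[ψ](N, W)`. Proof: for `ε > 0` the vector
`N + εW` is future-directed timelike with `g(N + εW, W) < 0`, so
`0 ≤ T(N + εW, W) = T(N, W) + ε T(W, W)` by the timelike case
(`LorentzianMetric.stressEnergy_nonneg_of_isTimelike`); let `ε ↓ 0`. Hawking–Ellis 1973, §4.3
(the scalar field obeys the dominant energy condition: `T(N, W) ≥ 0` for all future causal `N`,
`W`). [cite: HawkingEllis1973, §4.3] -/
theorem stressEnergy_nonneg_of_isFutureDirected {N W : TangentSpace I x}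
    (hN : τ.IsFutureDirected N) (hW : τ.IsFutureDirected W) (hWt : g.IsTimelike W) (ψ : M → ℝ) :
    0 ≤ g.stressEnergy ψ x N W := by
  have hc : 0 ≤ g.stressEnergy ψ x W W := g.stressEnergy_self_nonneg hWt ψ
  -- `T(N, W) + ε T(W, W) ≥ 0` for every `ε > 0`
  have hε : ∀ ε : ℝ, 0 < ε → 0 ≤ g.stressEnergy ψ x N W + ε * g.stressEnergy ψ x W W := by
    intro ε hε
    have hεW : τ.IsFutureDirected (ε • W) := hW.smul_pos τ hε
    have hεWt : g.IsTimelike (ε • W) := by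
      have h : g.val x W W < 0 := hWt
      show g.val x (ε • W) (ε • W) < 0
      simp only [map_smul, smul_apply, smul_eq_mul]
      exact mul_neg_of_pos_of_neg hε (mul_neg_of_pos_of_neg hε h)
    have hXt : g.IsTimelike (N + ε • W) := hN.isTimelike_add_right τ hεW hεWt
    have hX : τ.IsFutureDirected (N + ε • W) := hN.add τ hεW
    have hXW : g.val x (N + ε • W) W < 0 := hX.val_lt_zero τ hXt hW
    have hT := g.stressEnergy_nonneg_of_isTimelike hXt hWt hXW ψ
    have hexp : g.stressEnergy ψ x (N + ε • W) W =
        g.stressEnergy ψ x N W + ε * g.stressEnergy ψ x W W := by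
      rw [LinearMap.map_add, LinearMap.map_smul, LinearMap.add_apply, LinearMap.smul_apply,
        smul_eq_mul]
    linarith [hT, hexp]
  -- let `ε ↓ 0`
  rcases hc.eq_or_lt with h0 | hpos
  · have := hε 1 one_pos
    rw [← h0, mul_zero, add_zero] at this
    exact this
  · by_contra hneg
    push Not at hneg
    have hc0 : g.stressEnergy ψ x W W ≠ 0 := hpos.ne'
    have h := hε (-(g.stressEnergy ψ x N W) / (2 * g.stressEnergy ψ x W W))
      (div_pos (by linarith) (by linarith))
    have key : -(g.stressEnergy ψ x N W) / (2 * g.stressEnergy ψ x W W) *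
        g.stressEnergy ψ x W W = -(g.stressEnergy ψ x N W) / 2 := by
      field_simp
    linarith [h, key]

/-- **Monotonicity of the energy density in the multiplier**: if `X − Y` is future-directed causal
(or zero) and `W` is future-directed timelike, then `T[ψ](Y, W) ≤ T[ψ](X, W)` (bilinearity and the
dominant energy condition for `X − Y`). Hawking–Ellis 1973, §4.3. [cite: HawkingEllis1973, §4.3] -/
theorem stressEnergy_le_of_isFutureDirected_sub {X Y W : TangentSpace I x}
    (hXY : X - Y = 0 ∨ τ.IsFutureDirected (X - Y)) (hW : τ.IsFutureDirected W)
    (hWt : g.IsTimelike W) (ψ : M → ℝ) :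
    g.stressEnergy ψ x Y W ≤ g.stressEnergy ψ x X W := by
  have hsub : g.stressEnergy ψ x X W - g.stressEnergy ψ x Y W = g.stressEnergy ψ x (X - Y) W := by
    rw [LinearMap.map_sub, LinearMap.sub_apply]
  rcases hXY with h0 | hfd
  · have : g.stressEnergy ψ x (X - Y) W = 0 := by rw [h0, LinearMap.map_zero, LinearMap.zero_apply]
    linarith [hsub, this]
  · have := stressEnergy_nonneg_of_isFutureDirected τ hfd hW hWt ψ
    linarith [hsub, this]

/-- The same with a constant: if `c • X − Y` is future-directed causal (or zero) and `W` is
future-directed timelike, then `T[ψ](Y, W) ≤ c · T[ψ](X, W)`. Hawking–Ellis 1973, §4.3.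
[cite: HawkingEllis1973, §4.3] -/
theorem stressEnergy_le_mul_of_isFutureDirected_sub {X Y W : TangentSpace I x} {c : ℝ}
    (hXY : c • X - Y = 0 ∨ τ.IsFutureDirected (c • X - Y)) (hW : τ.IsFutureDirected W)
    (hWt : g.IsTimelike W) (ψ : M → ℝ) :
    g.stressEnergy ψ x Y W ≤ c * g.stressEnergy ψ x X W := by
  have h := stressEnergy_le_of_isFutureDirected_sub τ hXY hW hWt ψ
  rwa [LinearMap.map_smul₂, smul_eq_mul] at h

end LorentzianMetric

end DEC

/-! ### The vectors `∂_{t*}`, `−ℓ♯`, `V − ∂_{t*}`, `2∂_{t*} − V` on the Kerr exterior -/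

namespace Kerr

/-- `g(∂_{t*}, ∂_{t*}) = −1 + 2H` (`g = η + 2Hℓ ⊗ ℓ`, `ℓ₀ = 1`). DRSR arXiv:1402.7034, §2.2.4 (the
ergoregion is where this is positive). [cite: DafermosRodnianskiShlapentokhrothman2014, §2.2.4] -/
theorem bilin_basisVector_zero_basisVector_zero (M a : ℝ) (x : E4) :
    bilin M a x (E4.basisVector 0) (E4.basisVector 0) = -1 + 2 * scalarH M a x := by
  rw [bilin_apply, Minkowski.bilin_basisVector_zero, nullCovector_basisVector_zero]
  ring

/-- `g(∂_{t*}, ℓ♯) = ℓ(∂_{t*}) = 1` wherever `r > 0`. Kerr–Schild 1965, §2. [cite: KerrSchild1965, §2] -/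
theorem bilin_basisVector_zero_nullVector (M a : ℝ) {x : E4} (hx : 0 < radius a x) :
    bilin M a x (E4.basisVector 0) (nullVector a x) = 1 := by
  rw [bilin_apply, bilin_nullVector_right, nullCovector_basisVector_zero, nullCovector_nullVector hx]
  ring

/-- `ℓ♯` is `g`-null wherever `r > 0`: `g(ℓ♯, ℓ♯) = 0`. Kerr–Schild 1965, §2. [cite: KerrSchild1965, §2] -/
theorem bilin_nullVector_nullVector (M a : ℝ) {x : E4} (hx : 0 < radius a x) :
    bilin M a x (nullVector a x) (nullVector a x) = 0 := by
  rw [bilin_apply, bilin_nullVector, nullCovector_nullVector hx]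
  ring

/-- `(ℓ♯)⁰ = −1 ≠ 0`: the null vector is not zero. [folklore] -/
theorem nullVector_ne_zero (a : ℝ) (x : E4) : nullVector a x ≠ 0 := by
  intro h
  have := congrArg (fun v : E4 ↦ v 0) h
  simp [nullVector_apply_zero] at this

/-- `V − ∂_{t*} = 2H · (−ℓ♯)` (`V = ∂_{t*} − 2Hℓ♯`, `Kerr.timeVector`). Dafermos–Rodnianski
arXiv:0811.0354, §5.1. [cite: DafermosRodnianski2008, §5.1] -/
theorem timeVector_sub_basisVector_zero (M a : ℝ) (x : E4) :
    timeVector M a x - E4.basisVector 0 = (2 * scalarH M a x) • (-nullVector a x) := by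
  simp only [timeVector, smul_neg]
  abel

/-- `H > 0` on the chart domain of a Kerr metric with `M > 0` (`H = Mr³/(r⁴ + a²z²)`, `r > 0`).
Visser arXiv:0706.0622, (33). [cite: arXiv07060622, (33)] -/
theorem scalarH_pos {M a : ℝ} (hM : 0 < M) {x : E4} (hx : 0 < radius a x) : 0 < scalarH M a x := by
  unfold scalarH
  positivity

/-- `H ≤ 1/8` at exterior points with Kerr–Schild radius `r ≥ 8M` (`H ≤ M/r`,
`Kerr.scalarH_le_div`). [folklore] -/
theorem scalarH_le_one_div_eight {M a : ℝ} (hM : 0 ≤ M) {x : E4} (hx : 0 < radius a x)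
    (hr : 8 * M ≤ radius a x) : scalarH M a x ≤ 1 / 8 := by
  have h := scalarH_le_div hM a hx
  have : M / radius a x ≤ 1 / 8 := by
    rw [div_le_div_iff₀ hx (by norm_num : (0 : ℝ) < 8)]
    linarith
  exact h.trans this

variable [Facts]

/-- **`∂_{t*}` is future-directed timelike on the exterior wherever `2H < 1`** (outside the
ergoregion; for the Kerr time orientation `V = −g♯dt*`, `g(V, ∂_{t*}) = −1`). DRSR
arXiv:1402.7034, §2.2.2, §2.2.4. [cite: DafermosRodnianskiShlapentokhrothman2014, §2.2.2 and §2.2.4] -/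
theorem isFutureDirected_basisVector_zero {M a : ℝ} (hM : 0 ≤ M) (x : region a (rPlus M a))
    (hH : 2 * scalarH M a x.1 < 1) :
    (smoothMetric M a (rPlus M a)).IsTimelike (x := x) (E4.basisVector 0) ∧
      ((timeOrientation M a (rPlus M a) hM).ofLE le_top :
        TimeOrientation (smoothMetric M a (rPlus M a))).IsFutureDirected (x := x)
          (E4.basisVector 0) := by
  have hx := radius_pos_of_mem_region x.2
  have ht : (smoothMetric M a (rPlus M a)).IsTimelike (x := x) (E4.basisVector 0) := by
    show bilin M a x.1 (E4.basisVector 0) (E4.basisVector 0) < 0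
    rw [bilin_basisVector_zero_basisVector_zero]
    linarith
  refine ⟨ht, ht.isCausal, ?_⟩
  · show bilin M a x.1 (timeVector M a x.1) (E4.basisVector 0) < 0
    rw [bilin_timeVector hx]
    simp [E4.basisVector]

/-- **`−ℓ♯` is future-directed null on the exterior** (`g(ℓ♯, ℓ♯) = 0`, `g(V, −ℓ♯) = −1`; the
Kerr–Schild null vector `ℓ♯ = (−1, ℓ⃗)` is the past-directed ingoing principal null direction).
Kerr–Schild 1965, §2. [cite: KerrSchild1965, §2] -/
theorem isFutureDirected_neg_nullVector {M a : ℝ} (hM : 0 ≤ M) (x : region a (rPlus M a)) :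
    ((timeOrientation M a (rPlus M a) hM).ofLE le_top :
      TimeOrientation (smoothMetric M a (rPlus M a))).IsFutureDirected (x := x)
        (-nullVector a x.1) := by
  have hx := radius_pos_of_mem_region x.2
  refine ⟨⟨?_, neg_ne_zero.2 (nullVector_ne_zero a x.1)⟩, ?_⟩
  · show bilin M a x.1 (-nullVector a x.1) (-nullVector a x.1) ≤ 0
    rw [E4.bilin_neg_neg, bilin_nullVector_nullVector M a hx]
  · show bilin M a x.1 (timeVector M a x.1) (-nullVector a x.1) < 0
    rw [bilin_timeVector hx, WithLp.ofLp_neg, Pi.neg_apply, nullVector_apply_zero]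
    norm_num

/-- **`V − ∂_{t*}` is future-directed causal on the exterior** (`= 2H(−ℓ♯)` with `H > 0`), for
`M > 0`. [folklore] -/
theorem isFutureDirected_timeVector_sub_basisVector_zero {M a : ℝ} (hM : 0 < M)
    (x : region a (rPlus M a)) :
    ((timeOrientation M a (rPlus M a) hM.le).ofLE le_top :
      TimeOrientation (smoothMetric M a (rPlus M a))).IsFutureDirected (x := x)
        (timeVector M a x.1 - E4.basisVector 0) := by
  rw [timeVector_sub_basisVector_zero]
  exact (isFutureDirected_neg_nullVector hM.le x).smul_pos _
    (mul_pos two_pos (scalarH_pos hM (radius_pos_of_mem_region x.2)))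

/-- **`2∂_{t*} − V` is future-directed timelike where `H ≤ 1/8`**:
`2∂_{t*} − V = ∂_{t*} + 2Hℓ♯` has `g(·,·) = −1 + 6H < 0` and `g(V, ·) = −1 + 2H < 0`. [folklore] -/
theorem isFutureDirected_two_smul_basisVector_zero_sub_timeVector {M a : ℝ} (hM : 0 ≤ M)
    (x : region a (rPlus M a)) (hH : scalarH M a x.1 ≤ 1 / 8) :
    (smoothMetric M a (rPlus M a)).IsTimelike (x := x)
        ((2 : ℝ) • E4.basisVector 0 - timeVector M a x.1) ∧
      ((timeOrientation M a (rPlus M a) hM).ofLE le_top :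
        TimeOrientation (smoothMetric M a (rPlus M a))).IsFutureDirected (x := x)
          ((2 : ℝ) • E4.basisVector 0 - timeVector M a x.1) := by
  have hx := radius_pos_of_mem_region x.2
  have hZ : (2 : ℝ) • E4.basisVector 0 - timeVector M a x.1 =
      E4.basisVector 0 + (2 * scalarH M a x.1) • nullVector a x.1 := by
    simp only [timeVector]
    module
  have hval : bilin M a x.1 ((2 : ℝ) • E4.basisVector 0 - timeVector M a x.1)
      ((2 : ℝ) • E4.basisVector 0 - timeVector M a x.1) = -1 + 6 * scalarH M a x.1 := by
    rw [hZ]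
    simp only [map_add, map_smul, add_apply, smul_apply, smul_eq_mul,
      bilin_basisVector_zero_basisVector_zero, bilin_basisVector_zero_nullVector M a hx,
      bilin_nullVector_nullVector M a hx]
    rw [bilin_symm M a x.1 (nullVector a x.1) (E4.basisVector 0),
      bilin_basisVector_zero_nullVector M a hx]
    ring
  have ht : (smoothMetric M a (rPlus M a)).IsTimelike (x := x)
      ((2 : ℝ) • E4.basisVector 0 - timeVector M a x.1) := by
    show bilin M a x.1 _ _ < 0
    rw [hval]
    linarith
  refine ⟨ht, ht.isCausal, ?_⟩
  · show bilin M a x.1 (timeVector M a x.1) ((2 : ℝ) • E4.basisVector 0 - timeVector M a x.1) < 0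
    rw [bilin_timeVector hx]
    have h2H : 2 * scalarH M a x.1 < 1 := by linarith
    simp only [timeVector, WithLp.ofLp_sub, WithLp.ofLp_smul, Pi.sub_apply, Pi.smul_apply,
      smul_eq_mul, nullVector_apply_zero]
    simp [E4.basisVector]
    linarith

/-! ### Comparability of `T(∂_{t*}, W)` and `T(V, W)` for future timelike `W` -/

/-- **`T[ψ](∂_{t*}, W) ≤ T[ψ](V, W)` on the whole exterior** for every future-directed timelike `W`
and `M > 0` (`V − ∂_{t*} = 2H(−ℓ♯)` is future causal; dominant energy condition). DRSR
arXiv:1402.7034, §3.1 (footnote on `N`). [cite: DafermosRodnianskiShlapentokhrothman2014, §3.1] -/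
theorem stressEnergy_basisVector_zero_le_timeVector {M a : ℝ} (hM : 0 < M)
    (x : region a (rPlus M a)) {W : E4}
    (hW : ((timeOrientation M a (rPlus M a) hM.le).ofLE le_top :
      TimeOrientation (smoothMetric M a (rPlus M a))).IsFutureDirected (x := x) W)
    (hWt : (smoothMetric M a (rPlus M a)).IsTimelike (x := x) W)
    (ψ : region a (rPlus M a) → ℝ) :
    (smoothMetric M a (rPlus M a)).stressEnergy ψ x (E4.basisVector 0) W ≤
      (smoothMetric M a (rPlus M a)).stressEnergy ψ x (timeVector M a x.1) W :=
  LorentzianMetric.stressEnergy_le_of_isFutureDirected_sub _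
    (Or.inr (isFutureDirected_timeVector_sub_basisVector_zero hM x)) hW hWt ψ

/-- **`T[ψ](V, W) ≤ 2 T[ψ](∂_{t*}, W)` where `H ≤ 1/8`** (e.g. `r ≥ 8M`), for every future-directed
timelike `W` (`2∂_{t*} − V` is future timelike there; dominant energy condition). DRSR
arXiv:1402.7034, §3.1 (footnote on `N`). [cite: DafermosRodnianskiShlapentokhrothman2014, §3.1] -/
theorem stressEnergy_timeVector_le_two_mul {M a : ℝ} (hM : 0 ≤ M) (x : region a (rPlus M a))
    (hH : scalarH M a x.1 ≤ 1 / 8) {W : E4}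
    (hW : ((timeOrientation M a (rPlus M a) hM).ofLE le_top :
      TimeOrientation (smoothMetric M a (rPlus M a))).IsFutureDirected (x := x) W)
    (hWt : (smoothMetric M a (rPlus M a)).IsTimelike (x := x) W)
    (ψ : region a (rPlus M a) → ℝ) :
    (smoothMetric M a (rPlus M a)).stressEnergy ψ x (timeVector M a x.1) W ≤
      2 * (smoothMetric M a (rPlus M a)).stressEnergy ψ x (E4.basisVector 0) W := by
  exact LorentzianMetric.stressEnergy_le_mul_of_isFutureDirected_sub _
    (Or.inr (isFutureDirected_two_smul_basisVector_zero_sub_timeVector hM x hH).2) hW hWt ψ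

/-- **`0 ≤ T[ψ](∂_{t*}, W)` where `2H < 1`**, for every future-directed timelike `W` (`∂_{t*}` is
future timelike there; dominant energy condition, `LorentzianMetric.stressEnergy_nonneg_of_isTimelike`).
DRSR arXiv:1402.7034, §2.2.2, §2.3.2. [cite: DafermosRodnianskiShlapentokhrothman2014, §2.3.2] -/
theorem stressEnergy_basisVector_zero_nonneg {M a : ℝ} (hM : 0 ≤ M) (x : region a (rPlus M a))
    (hH : 2 * scalarH M a x.1 < 1) {W : E4}
    (hW : ((timeOrientation M a (rPlus M a) hM).ofLE le_top :
      TimeOrientation (smoothMetric M a (rPlus M a))).IsFutureDirected (x := x) W)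
    (hWt : (smoothMetric M a (rPlus M a)).IsTimelike (x := x) W)
    (ψ : region a (rPlus M a) → ℝ) :
    0 ≤ (smoothMetric M a (rPlus M a)).stressEnergy ψ x (E4.basisVector 0) W := by
  obtain ⟨ht, hfd⟩ := isFutureDirected_basisVector_zero hM x hH
  exact LorentzianMetric.stressEnergy_nonneg_of_isTimelike _ ht hWt (hfd.val_lt_zero _ ht hW) ψ

/-! ### The leaf normals and the slice normal -/

/-- The slice normal `V` is future-directed timelike (it is the orienting field). [folklore] -/
theorem isFutureDirected_timeVector {M a : ℝ} (hM : 0 ≤ M) (x : region a (rPlus M a)) :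
    (smoothMetric M a (rPlus M a)).IsTimelike (x := x) (timeVector M a x.1) ∧
      ((timeOrientation M a (rPlus M a) hM).ofLE le_top :
        TimeOrientation (smoothMetric M a (rPlus M a))).IsFutureDirected (x := x)
          (timeVector M a x.1) :=
  ⟨((timeOrientation M a (rPlus M a) hM).ofLE le_top :
      TimeOrientation (smoothMetric M a (rPlus M a))).isTimelike x,
    ((timeOrientation M a (rPlus M a) hM).ofLE le_top :
      TimeOrientation (smoothMetric M a (rPlus M a))).isFutureDirected_vectorField x⟩

/-- **Comparability through the leaves `Σ̃_τ(h♯_{R₁})`** (`|a| < M`, `R₁ > 2M`): at every exterior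
point `x` with `H(x) ≤ 1/8`, writing `W = −g♯d(t* − h♯_{R₁})` for the leaf normal,
`0 ≤ T(∂_{t*}, W) ≤ T(V, W) ≤ 2 T(∂_{t*}, W)`. DRSR arXiv:1402.7034, §3.1, §3.3.
[cite: DafermosRodnianskiShlapentokhrothman2014, §3.1 and §3.3] -/
theorem stressEnergy_leafNormal_scriHeight_comparison {M a R₁ : ℝ} (hMa : IsSubextremal M a)
    (hR : 2 * M < R₁) (x : region a (rPlus M a)) (hH : scalarH M a x.1 ≤ 1 / 8)
    (ψ : region a (rPlus M a) → ℝ) :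
    0 ≤ (smoothMetric M a (rPlus M a)).stressEnergy ψ x (E4.basisVector 0)
        (leafNormal M a (scriHeight M a R₁) x) ∧
      (smoothMetric M a (rPlus M a)).stressEnergy ψ x (E4.basisVector 0)
          (leafNormal M a (scriHeight M a R₁) x) ≤
        (smoothMetric M a (rPlus M a)).stressEnergy ψ x (timeVector M a x.1)
          (leafNormal M a (scriHeight M a R₁) x) ∧
      (smoothMetric M a (rPlus M a)).stressEnergy ψ x (timeVector M a x.1)
          (leafNormal M a (scriHeight M a R₁) x) ≤
        2 * (smoothMetric M a (rPlus M a)).stressEnergy ψ x (E4.basisVector 0)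
          (leafNormal M a (scriHeight M a R₁) x) := by
  have hW := isFutureDirected_leafNormal_scriHeight hMa hR x
  have hWt := isTimelike_leafNormal_scriHeight hMa hR x
  have h2H : 2 * scalarH M a x.1 < 1 := by linarith
  exact ⟨stressEnergy_basisVector_zero_nonneg hMa.pos.le x h2H hW hWt ψ,
    stressEnergy_basisVector_zero_le_timeVector hMa.pos x hW hWt ψ,
    stressEnergy_timeVector_le_two_mul hMa.pos.le x hH hW hWt ψ⟩

/-- **Comparability through the slices `{t* = const}`**: at every exterior point `x` with
`H(x) ≤ 1/8`, `0 ≤ T(∂_{t*}, V) ≤ T(V, V) ≤ 2 T(∂_{t*}, V)`. DRSR arXiv:1402.7034, §3.1.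
[cite: DafermosRodnianskiShlapentokhrothman2014, §3.1] -/
theorem stressEnergy_timeVector_comparison {M a : ℝ} (hM : 0 < M) (x : region a (rPlus M a))
    (hH : scalarH M a x.1 ≤ 1 / 8) (ψ : region a (rPlus M a) → ℝ) :
    0 ≤ (smoothMetric M a (rPlus M a)).stressEnergy ψ x (E4.basisVector 0) (timeVector M a x.1) ∧
      (smoothMetric M a (rPlus M a)).stressEnergy ψ x (E4.basisVector 0) (timeVector M a x.1) ≤
        (smoothMetric M a (rPlus M a)).stressEnergy ψ x (timeVector M a x.1) (timeVector M a x.1) ∧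
      (smoothMetric M a (rPlus M a)).stressEnergy ψ x (timeVector M a x.1) (timeVector M a x.1) ≤
        2 * (smoothMetric M a (rPlus M a)).stressEnergy ψ x (E4.basisVector 0)
          (timeVector M a x.1) := by
  obtain ⟨hWt, hW⟩ := isFutureDirected_timeVector hM.le x
  have h2H : 2 * scalarH M a x.1 < 1 := by linarith
  exact ⟨stressEnergy_basisVector_zero_nonneg hM.le x h2H hW hWt ψ,
    stressEnergy_basisVector_zero_le_timeVector hM x hW hWt ψ,
    stressEnergy_timeVector_le_two_mul hM.le x hH hW hWt ψ⟩

/-! ### Coordinate forms -/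

/-- **`T[ψ](∂_{t*}, W) = −∑_μ (J^T)^μ n_μ` on the leaves**: the analogue of
`Kerr.stressEnergy_timeVector_leafNormal_eq` (`KerrSchildLeafCurrents.lean`) for the Killing
multiplier `T = ∂_{t*}` (components `δ^α_0`, as in `Kerr.tCurrent_eq_multiplierCurrent`).
DRSR arXiv:1402.7034, §2.3.1. [cite: DafermosRodnianskiShlapentokhrothman2014, §2.3.1] -/
theorem stressEnergy_basisVector_zero_leafNormal_eq (M a : ℝ) {ψ : region a (rPlus M a) → ℝ}
    {Φ : E4 → ℝ} (hψ : ∀ y, ψ y = Φ y) (h : E3 → ℝ) (x : region a (rPlus M a))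
    (hΦ : DifferentiableAt ℝ Φ x) :
    (smoothMetric M a (rPlus M a)).stressEnergy ψ x (E4.basisVector 0) (leafNormal M a h x) =
      -∑ μ, KerrSchild.multiplierCurrent (inverseMetric M a)
        (fun _ ν ↦ if ν = 0 then (1 : ℝ) else 0) Φ x μ * graphConormal h (E4.spatial x.1) μ := by
  have hY : ∀ α : Fin 4, (fun (_ : E4) (ν : Fin 4) ↦ if ν = 0 then (1 : ℝ) else 0) x.1 α =
      (E4.basisVector 0 : E4) α := by
    intro α
    by_cases hα : α = 0
    · subst hα; simp [E4.basisVector]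
    · simp [E4.basisVector, hα]
  have key : (smoothMetric M a (rPlus M a)).stressEnergy ψ x (E4.basisVector 0)
      (-coSharp M a x.1 (E4.covector (graphConormal h (E4.spatial x.1)) : E4 →L[ℝ] ℝ)) =
      -∑ μ, KerrSchild.multiplierCurrent (inverseMetric M a)
        (fun _ ν ↦ if ν = 0 then (1 : ℝ) else 0) Φ x μ * graphConormal h (E4.spatial x.1) μ := by
    rw [show (smoothMetric M a (rPlus M a)).stressEnergy ψ x (E4.basisVector 0)
        (-coSharp M a x.1 (E4.covector (graphConormal h (E4.spatial x.1)) : E4 →L[ℝ] ℝ)) =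
        -(smoothMetric M a (rPlus M a)).stressEnergy ψ x (E4.basisVector 0)
          (coSharp M a x.1 (E4.covector (graphConormal h (E4.spatial x.1)) : E4 →L[ℝ] ℝ)) from
        LinearMap.BilinForm.neg_right _ _,
      sum_multiplierCurrent_mul_eq_stressEnergy M a (rPlus M a) hψ x hΦ
        (X := fun _ ν ↦ if ν = 0 then (1 : ℝ) else 0) (Y := E4.basisVector 0) hY]
  unfold leafNormal
  rw [sharp_smoothMetric, ← covector_graphConormal_eq_leafConormal]
  exact key

/-- **Coordinate comparability through the leaves `Σ̃_τ(h♯_{R₁})`.** For `|a| < M`, `R₁ > 2M`, at an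
exterior point `x` with `H(x) ≤ 1/8`, and for `ψ` represented by `Φ` differentiable at `x`: with
`(J^T)^μ`, `(J^V)^μ` the currents of `∂_{t*}` and `V` for `g⁻¹_{M,a}` and `n` the graph conormal of
`h♯_{R₁}` at `x⃗`,
`0 ≤ −∑(J^T)^μ n_μ`, `−∑(J^T)^μ n_μ ≤ −∑(J^V)^μ n_μ`, `−∑(J^V)^μ n_μ ≤ 2(−∑(J^T)^μ n_μ)`.
DRSR arXiv:1402.7034, §3.1, §3.3. [cite: DafermosRodnianskiShlapentokhrothman2014, §3.1 and §3.3] -/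
theorem neg_sum_tMultiplierCurrent_leaf_comparison {M a R₁ : ℝ} (hMa : IsSubextremal M a)
    (hR : 2 * M < R₁) {ψ : region a (rPlus M a) → ℝ} {Φ : E4 → ℝ} (hψ : ∀ y, ψ y = Φ y)
    (x : region a (rPlus M a)) (hH : scalarH M a x.1 ≤ 1 / 8) (hΦ : DifferentiableAt ℝ Φ x) :
    0 ≤ -∑ μ, KerrSchild.multiplierCurrent (inverseMetric M a)
        (fun _ ν ↦ if ν = 0 then (1 : ℝ) else 0) Φ x μ *
          graphConormal (scriHeight M a R₁) (E4.spatial x.1) μ ∧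
      -∑ μ, KerrSchild.multiplierCurrent (inverseMetric M a)
          (fun _ ν ↦ if ν = 0 then (1 : ℝ) else 0) Φ x μ *
            graphConormal (scriHeight M a R₁) (E4.spatial x.1) μ ≤
        -∑ μ, KerrSchild.multiplierCurrent (inverseMetric M a) (fun z α ↦ timeVector M a z α) Φ x μ *
          graphConormal (scriHeight M a R₁) (E4.spatial x.1) μ ∧
      -∑ μ, KerrSchild.multiplierCurrent (inverseMetric M a) (fun z α ↦ timeVector M a z α) Φ x μ *
          graphConormal (scriHeight M a R₁) (E4.spatial x.1) μ ≤
        2 * -∑ μ, KerrSchild.multiplierCurrent (inverseMetric M a)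
          (fun _ ν ↦ if ν = 0 then (1 : ℝ) else 0) Φ x μ *
            graphConormal (scriHeight M a R₁) (E4.spatial x.1) μ := by
  rw [← stressEnergy_basisVector_zero_leafNormal_eq M a hψ _ x hΦ,
    ← stressEnergy_timeVector_leafNormal_eq M a hψ _ x hΦ]
  exact stressEnergy_leafNormal_scriHeight_comparison hMa hR x hH ψ

/-- **Coordinate comparability through the slices `{t* = const}`** (conormal `dt* = (1, 0, 0, 0)`,
normal `V`): at an exterior point `x` with `H(x) ≤ 1/8`, for `M > 0` and `ψ` represented by `Φ`
differentiable at `x`,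
`0 ≤ −(J^T)⁰`, `−(J^T)⁰ ≤ −(J^V)⁰`, `−(J^V)⁰ ≤ 2(−(J^T)⁰)` — the energy densities through the
slices entering the smeared layer terms of `KerrSchildTruncatedCurrent.lean`. DRSR arXiv:1402.7034,
§3.1. [cite: DafermosRodnianskiShlapentokhrothman2014, §3.1] -/
theorem neg_tMultiplierCurrent_slice_comparison {M a : ℝ} (hM : 0 < M)
    {ψ : region a (rPlus M a) → ℝ} {Φ : E4 → ℝ} (hψ : ∀ y, ψ y = Φ y)
    (x : region a (rPlus M a)) (hH : scalarH M a x.1 ≤ 1 / 8) (hΦ : DifferentiableAt ℝ Φ x) :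
    0 ≤ -KerrSchild.multiplierCurrent (inverseMetric M a)
        (fun _ ν ↦ if ν = 0 then (1 : ℝ) else 0) Φ x 0 ∧
      -KerrSchild.multiplierCurrent (inverseMetric M a)
          (fun _ ν ↦ if ν = 0 then (1 : ℝ) else 0) Φ x 0 ≤
        -KerrSchild.multiplierCurrent (inverseMetric M a) (fun z α ↦ timeVector M a z α) Φ x 0 ∧
      -KerrSchild.multiplierCurrent (inverseMetric M a) (fun z α ↦ timeVector M a z α) Φ x 0 ≤
        2 * -KerrSchild.multiplierCurrent (inverseMetric M a)
          (fun _ ν ↦ if ν = 0 then (1 : ℝ) else 0) Φ x 0 := by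
  -- the slice is the leaf of the zero height, with conormal `(1, 0, 0, 0)` and normal `V`
  have hn : ∀ (J : Fin 4 → ℝ), ∑ μ, J μ * graphConormal (fun _ : E3 ↦ (0 : ℝ)) (E4.spatial x.1) μ =
      J 0 := by
    intro J
    rw [Fin.sum_univ_four]
    simp [partialE3]
  have hW : leafNormal M a (fun _ : E3 ↦ (0 : ℝ)) x = timeVector M a x.1 :=
    leafNormal_eq_timeVector x (by simp)
  have hT := stressEnergy_basisVector_zero_leafNormal_eq M a hψ (fun _ : E3 ↦ (0 : ℝ)) x hΦ
  have hV := stressEnergy_timeVector_leafNormal_eq M a hψ (fun _ : E3 ↦ (0 : ℝ)) x hΦ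
  rw [hn, hW] at hT hV
  rw [← hT, ← hV]
  exact stressEnergy_timeVector_comparison hM x hH ψ

end Kerr

end Literature.Geometry.Lorentzian
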